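import Summits.ResolutionOfSingularities.ResolutionOfSingularities.Theorems.FrobeniusLadderFInjectiveMacaulayficationS2ModificationAffineSections
import Summits.ResolutionOfSingularities.ResolutionOfSingularities.Theorems.FrobeniusLadderFInjectiveMacaulayficationS2ModificationSections
import Summits.ResolutionOfSingularities.ResolutionOfSingularities.Theorems.FrobeniusLadderFInjectiveMacaulayficationS2ModificationAffineSpec
import Summits.ResolutionOfSingularities.ResolutionOfSingularities.Theorems.FrobeniusLadderFInjectiveMacaulayficationS2ModificationAffineClauses
import Mathlib.AlgebraicGeometry.Normalization
import HarnessLib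

/-!
# The S₂-modification as the relative normalisation in the open complement: the charts — file L4d of the `S2Modification` discharge
# (crux `FInjectiveMacaulayfication` stmt-ResolutionOfSingularities-15315, chain w45a, hole #3γ/FC″, rung r2 input S-S2
# `FCForallExistsDimLe2.S2Modification`; res-L1-w45a-plan-1 R15.16 «L4 → stub-2»; seat res-L1-w45a-stub-2)

[OURS · L1 W4.5a] Support file (`--supports stmt-ResolutionOfSingularities-15315 --as helper`); NOT a statement of any manuscript; no named
fact; no definitions; AI-written (AI review is weaker than expert review).

SETTING. `X` an integral scheme, `U₀ ⊆ X` open (the complement of the closed set `F`), `V ⊆ X` a non-empty affine open, and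
`s ⊆ Γ(X, V)` a non-empty finite set of non-zero sections with `U₀ ∩ V = ⋃_{f ∈ s} X.basicOpen f` (i.e. `F ∩ V = V(s)`), written as
`hVU : U₀.ι ''ᵁ (U₀.ι ⁻¹ᵁ V) = ⨆ f, X.basicOpen f`. Mathlib's relative normalisation `U₀.ι.normalization` of `X` in `U₀` has, over `V`,
the chart ring `integralClosure Γ(X, V) Γ(U₀, U₀.ι ⁻¹ᵁ V)` (`Scheme.Hom.normalizationObjIso`, algebra structure
`(U₀.ι.app V).hom.toAlgebra`). THIS FILE identifies that chart ring with the affine S₂-modification algebra and draws the consequences: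

* `exists_algEquiv_chart` — **`integralClosure Γ(X, V) Γ(U₀, U₀.ι ⁻¹ᵁ V) ≃ₐ[Γ(X,V)] s2Mod Γ(X, V) K(X) s hs`**, compatibly with the
  embeddings into `K(X)` (L4a `exists_algEquiv_integralClosure_s2Mod` + L4b `mem_range_germToFunctionField_iSup_iff`);
* `module_finite_integralClosure_chart` — the chart ring is a finite `Γ(X, V)`-module when `Γ(X, V)` is of finite type over a field
  (E. Noether, via L5 `module_finite_s2Mod_of_finiteType`) — the input of `isFinite_fromNormalization_of_finite`;
* `clauses_chart` — **at every prime `Q` of the chart ring containing `s`, `Localization.AtPrime Q` satisfies the Cohen–Macaulay clause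
  and is integrally closed when of dimension `≤ 1`** (`Γ(X, V)` of finite type over a field, `dim Γ(X, V) ≤ 2`; stub-3's
  `S2ModificationAffineClauses.clauses_atPrime_of_finiteType` transported along the chart isomorphism and
  `IsLocalization.ringEquivOfRingEquiv`); `clauses_of_algEquiv` is the transport lemma.

[folklore] [cite: EGAIV2, 5.10.16–17]
-/

-- single-problem summit: the doubled namespace component is forced
set_option linter.dupNamespace false

noncomputable section

namespace Summit.ResolutionOfSingularities.ResolutionOfSingularities.Theorems.FInjectiveMacaulayfication.S2ModificationCharts

open Summit.ResolutionOfSingularities.ResolutionOfSingularities.Theorems.FInjectiveMacaulayfication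
open S2ModificationAffine S2ModificationAffineSections S2ModificationSections S2ModificationAffineSpec S2ModificationAffineClauses
open CategoryTheory AlgebraicGeometry TopologicalSpace Opposite

/-! ## §1 Transport of the two clauses along an algebra isomorphism (pure algebra) -/

/-- The complement of a prime transported along a ring isomorphism. [folklore] -/
theorem map_primeCompl_eq {C D : Type} [CommRing C] [CommRing D] (e : C ≃+* D) (Q : Ideal C) [Q.IsPrime] :
    haveI : (Q.map e).IsPrime := Ideal.map_isPrime_of_equiv e
    Submonoid.map e.toMonoidHom Q.primeCompl = (Q.map e).primeCompl := by
  haveI : (Q.map e).IsPrime := Ideal.map_isPrime_of_equiv e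
  ext x
  rw [Submonoid.mem_map]
  constructor
  · rintro ⟨y, hy, rfl⟩
    intro hx
    apply hy
    have : e y ∈ Q.map (e : C →+* D) := hx
    rw [Ideal.map_comap_of_equiv, Ideal.mem_comap] at this
    simpa using this
  · intro hx
    refine ⟨e.symm x, fun hy => hx ?_, by simp⟩
    change x ∈ Q.map (e : C →+* D)
    rw [Ideal.map_comap_of_equiv, Ideal.mem_comap]
    exact hy

/-- **The Cohen–Macaulay clause and «integrally closed in dimension `≤ 1`» for `Localization.AtPrime Q` transport along an algebra
isomorphism `e : C ≃ D`** (from the prime `Q.map e` of `D` to the prime `Q` of `C`), via `IsLocalization.ringEquivOfRingEquiv`.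
[folklore] -/
theorem clauses_of_algEquiv {A C D : Type} [CommRing A] [CommRing C] [CommRing D] [Algebra A C] [Algebra A D]
    (e : C ≃ₐ[A] D) (Q : Ideal C) [Q.IsPrime]
    (h : haveI : (Q.map e.toRingEquiv).IsPrime := Ideal.map_isPrime_of_equiv e.toRingEquiv
      NonFullLocusClosed.CMClause (Localization.AtPrime (Q.map e.toRingEquiv)) ∧
        (ringKrullDim (Localization.AtPrime (Q.map e.toRingEquiv)) ≤ 1 →
          IsIntegrallyClosed (Localization.AtPrime (Q.map e.toRingEquiv)))) :
    NonFullLocusClosed.CMClause (Localization.AtPrime Q) ∧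
      (ringKrullDim (Localization.AtPrime Q) ≤ 1 → IsIntegrallyClosed (Localization.AtPrime Q)) := by
  haveI : (Q.map e.toRingEquiv).IsPrime := Ideal.map_isPrime_of_equiv e.toRingEquiv
  let eLoc : Localization.AtPrime Q ≃+* Localization.AtPrime (Q.map e.toRingEquiv) :=
    IsLocalization.ringEquivOfRingEquiv (M := Q.primeCompl) (T := (Q.map e.toRingEquiv).primeCompl)
      (Localization.AtPrime Q) (Localization.AtPrime (Q.map e.toRingEquiv)) e.toRingEquiv (map_primeCompl_eq e.toRingEquiv Q)
  obtain ⟨hCM, hIC⟩ := h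
  refine ⟨FiLocusOpenOfAffine.cmClause_of_ringEquiv eLoc.symm hCM, fun h1 => ?_⟩
  haveI : IsIntegrallyClosed (Localization.AtPrime (Q.map e.toRingEquiv)) :=
    hIC (by rwa [← ringKrullDim_eq_of_ringEquiv eLoc])
  exact IsIntegrallyClosed.of_equiv eLoc.symm

/-! ## §2 The chart ring of the relative normalisation over an affine open, inside `K(X)` -/

variable {X : Scheme.{0}} [IsIntegral X] (U₀ : X.Opens) {V : X.Opens} (hV : IsAffineOpen V) [Nonempty V]
  (s : Finset Γ(X, V)) (hs : ∀ f ∈ s, f ≠ 0) (hne : s.Nonempty)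
  (hVU : U₀.ι ''ᵁ (U₀.ι ⁻¹ᵁ V) = ⨆ f : s, X.basicOpen (f : Γ(X, V)))

include hs hne hVU in
/-- `U₀ ∩ V` is non-empty. [folklore] -/
theorem nonempty_image_preimage : Nonempty (U₀.ι ''ᵁ (U₀.ι ⁻¹ᵁ V) : X.Opens) := by
  rw [hVU]
  exact nonempty_iSup_basicOpen s hs hne

/-- **The chart ring of `U₀.ι.normalization` over `V` is the affine S₂-modification algebra**:
`integralClosure Γ(X, V) Γ(U₀, U₀.ι ⁻¹ᵁ V) ≃ₐ[Γ(X, V)] s2Mod Γ(X, V) K(X) s hs`, compatibly with the embeddings into `K(X)` (the structure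
map `Γ(X, V) → Γ(U₀, U₀.ι ⁻¹ᵁ V) = Γ(X, U₀ ∩ V)` is the restriction, `Scheme.Opens.ι_app`; the embedding is the germ at the generic point,
injective with range `⋂ Γ(X, V)[1/f]` by L4b). [folklore] [cite: EGAIV2, 5.10.16–17] -/
theorem exists_algEquiv_chart :
    letI := (U₀.ι.app V).hom.toAlgebra
    haveI := functionField_isFractionRing_of_isAffineOpen X V hV
    ∃ e : integralClosure Γ(X, V) Γ(↑U₀, U₀.ι ⁻¹ᵁ V) ≃ₐ[Γ(X, V)] s2Mod Γ(X, V) X.functionField s hs,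
      ∀ y : integralClosure Γ(X, V) Γ(↑U₀, U₀.ι ⁻¹ᵁ V),
        ((e y : s2Mod Γ(X, V) X.functionField s hs) : X.functionField) =
          X.germToFunctionField (U₀.ι ''ᵁ (U₀.ι ⁻¹ᵁ V)) (h := nonempty_image_preimage U₀ s hs hne hVU)
            (y : Γ(↑U₀, U₀.ι ⁻¹ᵁ V)) := by
  letI := (U₀.ι.app V).hom.toAlgebra
  haveI := functionField_isFractionRing_of_isAffineOpen X V hV
  haveI hW : Nonempty (U₀.ι ''ᵁ (U₀.ι ⁻¹ᵁ V) : X.Opens) := nonempty_image_preimage U₀ s hs hne hVU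
  -- the embedding of the chart ring into `K(X)`: the germ at the generic point
  let ι : Γ(↑U₀, U₀.ι ⁻¹ᵁ V) →ₐ[Γ(X, V)] X.functionField :=
    { (X.germToFunctionField (U₀.ι ''ᵁ (U₀.ι ⁻¹ᵁ V))).hom with
      commutes' := fun a => by
        change X.germToFunctionField (U₀.ι ''ᵁ (U₀.ι ⁻¹ᵁ V)) (algebraMap Γ(X, V) Γ(↑U₀, U₀.ι ⁻¹ᵁ V) a) =
          algebraMap Γ(X, V) X.functionField a
        rw [RingHom.algebraMap_toAlgebra, RingHom.algebraMap_toAlgebra, Scheme.Opens.ι_app]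
        exact germToFunctionField_map _ a }
  have hι : ∀ b, ι b = X.germToFunctionField (U₀.ι ''ᵁ (U₀.ι ⁻¹ᵁ V)) b := fun _ => rfl
  have hinj : Function.Injective ι := X.germToFunctionField_injective _
  have hrange : ∀ z : X.functionField, z ∈ Set.range ι ↔
      ∀ (f : Γ(X, V)) (hf : f ∈ s), z ∈ awaySub Γ(X, V) X.functionField f (hs f hf) := by
    intro z
    have key : ∀ (W : X.Opens), W = (⨆ f : s, X.basicOpen (f : Γ(X, V))) → ∀ (hWne : Nonempty W),
        (z ∈ Set.range (X.germToFunctionField W) ↔ ∀ (f : Γ(X, V)) (_ : f ∈ s), ∃ (a : Γ(X, V)) (n : ℕ),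
          z = X.germToFunctionField V a * (X.germToFunctionField V (f ^ n))⁻¹) := by
      rintro W rfl hWne
      exact mem_range_germToFunctionField_iSup_iff hV s hs hne z
    have hr : Set.range ι = Set.range (X.germToFunctionField (U₀.ι ''ᵁ (U₀.ι ⁻¹ᵁ V))) := rfl
    rw [hr, key _ hVU hW]
    refine forall₂_congr fun f hf => ?_
    rw [mem_awaySub_iff]
    rfl
  obtain ⟨e, he⟩ := exists_algEquiv_integralClosure_s2Mod Γ(X, V) X.functionField s hs _ ι hinj hrange
  exact ⟨e, fun y => (he y).trans (hι y)⟩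

/-! ## §3 Consequences: finiteness of the chart ring; the clauses over `F` at its primes -/

include hV hs hne hVU in
/-- **The chart ring is a finite `Γ(X, V)`-module** when `Γ(X, V)` is of finite type over a field (E. Noether via L5). This is the
hypothesis of `isFinite_fromNormalization_of_finite` for the chart `V`. [folklore] [cite: Liu2002, Cor. 4.1.30, p. 122] -/
theorem module_finite_integralClosure_chart (k : Type) [Field k] [Algebra k Γ(X, V)] [Algebra.FiniteType k Γ(X, V)] :
    letI := (U₀.ι.app V).hom.toAlgebra
    Module.Finite Γ(X, V) (integralClosure Γ(X, V) Γ(↑U₀, U₀.ι ⁻¹ᵁ V)) := by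
  letI := (U₀.ι.app V).hom.toAlgebra
  haveI := functionField_isFractionRing_of_isAffineOpen X V hV
  obtain ⟨e, -⟩ := exists_algEquiv_chart U₀ hV s hs hne hVU
  haveI := module_finite_s2Mod_of_finiteType Γ(X, V) X.functionField s hs k
  exact Module.Finite.equiv e.symm.toLinearEquiv

include hV hs hne hVU in
/-- **The clauses over `F` on a chart**: at every prime `Q ⊇ s` of the chart ring `integralClosure Γ(X, V) Γ(U₀, U₀.ι ⁻¹ᵁ V)`,
`Localization.AtPrime Q` satisfies the Cohen–Macaulay clause and is integrally closed when of dimension `≤ 1` (`Γ(X, V)` of finite type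
over a field `k`, `dim Γ(X, V) ≤ 2`; stub-3's `clauses_atPrime_of_finiteType` transported along `exists_algEquiv_chart`).
[folklore] [cite: EGAIV2, 5.10.16–17] -/
theorem clauses_chart (k : Type) [Field k] [Algebra k Γ(X, V)] [Algebra.FiniteType k Γ(X, V)]
    [Algebra k X.functionField] [IsScalarTower k Γ(X, V) X.functionField] (hdim : ringKrullDim Γ(X, V) ≤ 2) :
    letI := (U₀.ι.app V).hom.toAlgebra
    ∀ (Q : Ideal (integralClosure Γ(X, V) Γ(↑U₀, U₀.ι ⁻¹ᵁ V))) [Q.IsPrime],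
      (∀ (f : Γ(X, V)), f ∈ s → algebraMap Γ(X, V) (integralClosure Γ(X, V) Γ(↑U₀, U₀.ι ⁻¹ᵁ V)) f ∈ Q) →
        NonFullLocusClosed.CMClause (Localization.AtPrime Q) ∧
          (ringKrullDim (Localization.AtPrime Q) ≤ 1 → IsIntegrallyClosed (Localization.AtPrime Q)) := by
  letI := (U₀.ι.app V).hom.toAlgebra
  haveI := functionField_isFractionRing_of_isAffineOpen X V hV
  intro Q _ hQ
  obtain ⟨e, -⟩ := exists_algEquiv_chart U₀ hV s hs hne hVU
  haveI : (Q.map e.toRingEquiv).IsPrime := Ideal.map_isPrime_of_equiv e.toRingEquiv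
  refine clauses_of_algEquiv e Q (clauses_atPrime_of_finiteType Γ(X, V) X.functionField s hs (Q.map e.toRingEquiv) k hdim ?_)
  intro f hf
  have : e (algebraMap Γ(X, V) _ f) = algebraMap Γ(X, V) (s2Mod Γ(X, V) X.functionField s hs) f := e.commutes f
  rw [← this]
  exact Ideal.mem_map_of_mem e.toRingEquiv (hQ f hf)

end Summit.ResolutionOfSingularities.ResolutionOfSingularities.Theorems.FInjectiveMacaulayfication.S2ModificationCharts

end
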